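import Summits.KontsevichZagierPeriods.KontsevichZagierPeriods.Theses.FurushoPentagon
import Literature.NumberTheory.Transcendental.DrinfeldAssociatorRegularisation
import Literature.NumberTheory.Transcendental.AssociatorsHexagonProofs
import Literature.NumberTheory.Transcendental.DrinfeldAssociatorProofs
import Literature.NumberTheory.Transcendental.AssociatorsProofs
import Literature.NumberTheory.Transcendental.AssociatorsEval
import Literature.NumberTheory.Transcendental.KZLogCalculusProofs
import Summits.KontsevichZagierPeriods.KontsevichZagierPeriods.Theorems.FurushoPentagonPentagonInKZGroupLike
import Summits.KontsevichZagierPeriods.KontsevichZagierPeriods.Theorems.FurushoPentagonPentagonInKZPathFamilies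
import Summits.KontsevichZagierPeriods.KontsevichZagierPeriods.Theorems.FurushoPentagonPentagonInKZHalfEdgeUniversal
import Summits.KontsevichZagierPeriods.KontsevichZagierPeriods.Theorems.FurushoPentagonPentagonInKZShuffleProduct
import Summits.KontsevichZagierPeriods.KontsevichZagierPeriods.Theorems.FurushoPentagonPentagonInKZSimplexToCube
import Summits.KontsevichZagierPeriods.KontsevichZagierPeriods.Theorems.FurushoPentagonPentagonInKZRegEndCons
import Summits.KontsevichZagierPeriods.KontsevichZagierPeriods.Theorems.FurushoPentagonPentagonInKZOmegaCommute
import Summits.KontsevichZagierPeriods.KontsevichZagierPeriods.Theorems.FurushoPentagonPentagonInKZPolyIdentity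
import Summits.KontsevichZagierPeriods.KontsevichZagierPeriods.Theorems.FurushoPentagonPentagonInKZChartB
import Summits.KontsevichZagierPeriods.KontsevichZagierPeriods.Theorems.FurushoPentagonPentagonInKZLogfreeCorners
import Summits.KontsevichZagierPeriods.KontsevichZagierPeriods.Theorems.FurushoPentagonPentagonInKZAssemblyAlg

/-!
# `PentagonInKZ` (stmt-KontsevichZagierPeriods-11348): the crux, line `logfree-gauge-corner-flatness`

`PentagonInKZ_of : PentagonInKZ` — every additive, multiplicative, unital realisation `χ` of the
Kontsevich–Zagier rules sends the regularised MZV generating series to a solution of Drinfeld's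
pentagon.  Composition of the landed stubs `stub_pathFamilies`, `stub_shuffleProduct`,
`stub_groupLike`, `stub_halfEdgeUniversal`, `stub_chartB`, `stub_logfreeCorners` (← the corner
principle `stub_cornerPrinciple`), then the telescoping `pentagon_of_corners_group`.
[cite: Drinfeld1991, §2]; [cite: Furusho2010, §3]
-/

noncomputable section

open Literature.NumberTheory.Transcendental

namespace Summit.KontsevichZagierPeriods.FurushoPentagon.PentagonInKZ

open Summit.KontsevichZagierPeriods.KontsevichZagierPeriods.Theses.FurushoPentagon (PentagonInKZ)

/-! ## 3. The composition: the crux from the stubs -/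

/-- **The line closes the crux**: the six registered stubs imply `PentagonInKZ` (half-edge
factorisations by central shifts and the exponential law, then Drinfeld's telescoping over every
realisation). [cite: Drinfeld1991, §2] -/
theorem PentagonInKZ_of : PentagonInKZ := by
  intro R _ _ χ hrel hmul hunit Z hZ N
  classical
  obtain ⟨I, hI⟩ := stub_pathFamilies
  -- the log-free transports
  set P : Fin 15 → NCSeries (Fin 3) R := fun p W =>
    if W = [] then 1 else Shuffle.pair (fun w => χ (KZ.of (I p w))) (Shuffle.regEnd 0 W) with hPdef
  have hP : ∀ (p : Fin 15) (W : List (Fin 3)), P p W = if W = [] then 1 else Shuffle.pair (fun w => χ (KZ.of (I p w))) (Shuffle.regEnd 0 W) := fun _ _ => rfl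
  -- generators
  set a : DrinfeldKohnoTrunc R (Fin 4) N := DrinfeldKohnoTrunc.t R N 0 1 with ha
  set b : DrinfeldKohnoTrunc R (Fin 4) N := DrinfeldKohnoTrunc.t R N 0 2 with hb
  set c : DrinfeldKohnoTrunc R (Fin 4) N := DrinfeldKohnoTrunc.t R N 1 2 with hc
  set d : DrinfeldKohnoTrunc R (Fin 4) N := DrinfeldKohnoTrunc.t R N 1 3 with hd
  set e : DrinfeldKohnoTrunc R (Fin 4) N := DrinfeldKohnoTrunc.t R N 2 3 with he
  set args : Fin 15 → Fin 3 → DrinfeldKohnoTrunc R (Fin 4) N :=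
    ![![a + b + c, e, d], ![c, a, d], ![c + d + e, a + a + b + c, d], ![e, a + b + c, d], ![a, c, d],
      ![a, c, 0], ![a + b + c, e, 0], ![c, a, 0], ![a + b + c, d + e, 0], ![c + d + e, a + b + c, 0],
      ![c, d, 0], ![e, d, 0], ![c + d + e, a, 0], ![a, c + d, 0], ![e, a + b + c, 0]] with hargs
  set M : Fin 15 → DrinfeldKohnoTrunc R (Fin 4) N := fun p => NCSeries.evalTrunc N (args p) (P p)
    with hMdef
  have hM : ∀ p : Fin 15, M p = NCSeries.evalTrunc N (args p) (P p) := fun _ => rfl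
  set φ : NCSeries Bool R := fun W : List Bool => (-1 : R) ^ (W.count true) * (MZV.shuffleReg W).sum (fun v a => a • (if MZV.IsConvergentWord v then
      χ (Z (MZV.ofBinaryWord v)) else (0 : R))) with hφ
  set L : R := χ (KZ.of (I 5 [1])) with hL
  set E : DrinfeldKohnoTrunc R (Fin 4) N → DrinfeldKohnoTrunc R (Fin 4) N :=
    fun x => truncExp R N (L • x) with hEdef
  have hE : ∀ x, E x = truncExp R N (L • x) := fun _ => rfl
  -- the stubs
  obtain ⟨C1, C2, C3, C4, C5⟩ := stub_logfreeCorners R χ hrel hmul hunit I hI P hP N a b c d e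
    rfl rfl rfl rfl rfl M hM
  have hSh := stub_shuffleProduct I hI
  have hG : ∀ p : Fin 15, NCSeries.IsGroupLike (P p) := stub_groupLike R χ hrel hmul hunit I hI hSh P hP
  have hU := stub_halfEdgeUniversal R χ hrel hmul hunit Z hZ φ rfl I hI P hP hG N
  have hB := stub_chartB R χ hrel hmul hunit I hI P hP hG N
  -- weight-one memberships
  have ga : a ∈ (DrinfeldKohnoTrunc.genSpan : Submodule R (DrinfeldKohnoTrunc R (Fin 4) N)) := DrinfeldKohnoTrunc.t_mem_genSpan 0 1
  have gb : b ∈ (DrinfeldKohnoTrunc.genSpan : Submodule R (DrinfeldKohnoTrunc R (Fin 4) N)) := DrinfeldKohnoTrunc.t_mem_genSpan 0 2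
  have gc : c ∈ (DrinfeldKohnoTrunc.genSpan : Submodule R (DrinfeldKohnoTrunc R (Fin 4) N)) := DrinfeldKohnoTrunc.t_mem_genSpan 1 2
  have gd : d ∈ (DrinfeldKohnoTrunc.genSpan : Submodule R (DrinfeldKohnoTrunc R (Fin 4) N)) := DrinfeldKohnoTrunc.t_mem_genSpan 1 3
  have ge : e ∈ (DrinfeldKohnoTrunc.genSpan : Submodule R (DrinfeldKohnoTrunc R (Fin 4) N)) := DrinfeldKohnoTrunc.t_mem_genSpan 2 3
  have g0 : (0 : DrinfeldKohnoTrunc R (Fin 4) N) ∈ (DrinfeldKohnoTrunc.genSpan : Submodule R (DrinfeldKohnoTrunc R (Fin 4) N)) :=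
    Submodule.zero_mem _
  have gargs : ∀ (p : Fin 15) (i : Fin 3), args p i ∈ (DrinfeldKohnoTrunc.genSpan : Submodule R (DrinfeldKohnoTrunc R (Fin 4) N)) := by
    intro p i
    fin_cases p <;> fin_cases i <;>
      simp only [hargs] <;>
      first
        | exact g0
        | repeat (first | exact ga | exact gb | exact gc | exact gd | exact ge
                        | refine Submodule.add_mem _ ?_ ?_)
  have gabc : a + b + c ∈ (DrinfeldKohnoTrunc.genSpan : Submodule R (DrinfeldKohnoTrunc R (Fin 4) N)) := Submodule.add_mem _ (Submodule.add_mem _ ga gb) gc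
  have gab : a + b ∈ (DrinfeldKohnoTrunc.genSpan : Submodule R (DrinfeldKohnoTrunc R (Fin 4) N)) := Submodule.add_mem _ ga gb
  have gbc : b + c ∈ (DrinfeldKohnoTrunc.genSpan : Submodule R (DrinfeldKohnoTrunc R (Fin 4) N)) := Submodule.add_mem _ gb gc
  have gde : d + e ∈ (DrinfeldKohnoTrunc.genSpan : Submodule R (DrinfeldKohnoTrunc R (Fin 4) N)) := Submodule.add_mem _ gd ge
  have gcd : c + d ∈ (DrinfeldKohnoTrunc.genSpan : Submodule R (DrinfeldKohnoTrunc R (Fin 4) N)) := Submodule.add_mem _ gc gd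
  have gcde : c + d + e ∈ (DrinfeldKohnoTrunc.genSpan : Submodule R (DrinfeldKohnoTrunc R (Fin 4) N)) := Submodule.add_mem _ gcd ge
  -- the infinitesimal braid relations used
  have Fc_ab : Commute c (a + b) := by
    have h := DrinfeldKohnoTrunc.t_mul_add (R := R) (N := N) (1 : Fin 4) 2 0 (by decide) (by decide) (by decide)
    rw [DrinfeldKohnoTrunc.t_symm 1 0, DrinfeldKohnoTrunc.t_symm 2 0] at h
    exact h
  have Fc_de : Commute c (d + e) :=
    DrinfeldKohnoTrunc.t_mul_add (R := R) (N := N) (1 : Fin 4) 2 3 (by decide) (by decide) (by decide)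
  have Fa_bc : Commute a (b + c) :=
    DrinfeldKohnoTrunc.t_mul_add (R := R) (N := N) (0 : Fin 4) 1 2 (by decide) (by decide) (by decide)
  have Fa_e : Commute a e :=
    DrinfeldKohnoTrunc.t_comm (R := R) (N := N) (0 : Fin 4) 1 2 3 (by decide) (by decide) (by decide) (by decide) (by decide) (by decide)
  have Fe_cd : Commute e (c + d) := by
    have h := DrinfeldKohnoTrunc.t_mul_add (R := R) (N := N) (2 : Fin 4) 3 1 (by decide) (by decide) (by decide)
    rw [DrinfeldKohnoTrunc.t_symm 2 1, DrinfeldKohnoTrunc.t_symm 3 1] at h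
    exact h
  have Fd_ce : Commute d (c + e) := by
    have h := DrinfeldKohnoTrunc.t_mul_add (R := R) (N := N) (1 : Fin 4) 3 2 (by decide) (by decide) (by decide)
    rw [DrinfeldKohnoTrunc.t_symm 3 2] at h
    exact h
  -- derived commutations of the five central shifts
  have Zabc_a : Commute (a + b + c) a := by
    rw [add_assoc]; exact ((Commute.refl a).add_left Fa_bc.symm)
  have Zabc_c : Commute (a + b + c) c := Fc_ab.symm.add_left (Commute.refl c)
  have Zc_abc : Commute c (a + b + c) := Zabc_c.symm
  have Zc_de : Commute c (d + e) := Fc_de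
  have Zc_cde : Commute c (c + d + e) := by
    rw [add_assoc]; exact (Commute.refl c).add_right Fc_de
  have Zcde_c : Commute (c + d + e) c := Zc_cde.symm
  have Zcde_d : Commute (c + d + e) d := by
    have : c + d + e = d + (c + e) := by abel
    rw [this]; exact (Commute.refl d).add_left Fd_ce.symm
  have Zcde_e : Commute (c + d + e) e := Fe_cd.symm.add_left (Commute.refl e)
  have Za_e : Commute a e := Fa_e
  have Za_abc : Commute a (a + b + c) := Zabc_a.symm
  have Ze_a : Commute e a := Fa_e.symm
  have Ze_cd : Commute e (c + d) := Fe_cd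
  have Ze_cde : Commute e (c + d + e) := Zcde_e.symm
  have Zany_0 : ∀ x : DrinfeldKohnoTrunc R (Fin 4) N, Commute x 0 := fun x => Commute.zero_right x
  -- exponential identities and commutations
  have KE : ∀ x y : DrinfeldKohnoTrunc R (Fin 4) N, Commute x y → E x * E y = E y * E x :=
    fun x y h => by
      rw [hE, hE]; exact (commute_truncExp_smul (Commute.truncExp_right (h.smul_right L) N) L).eq
  have EE : ∀ x y : DrinfeldKohnoTrunc R (Fin 4) N, Commute x y → x ∈ (DrinfeldKohnoTrunc.genSpan : Submodule R (DrinfeldKohnoTrunc R (Fin 4) N)) → y ∈ (DrinfeldKohnoTrunc.genSpan : Submodule R (DrinfeldKohnoTrunc R (Fin 4) N)) → E x * E y = E (x + y) := fun x y h hx hy => by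
    rw [hE, hE, hE]; exact truncExp_smul_mul_truncExp_smul h hx hy L
  /- ### Part (i): the five half-edge factorisations from the universal stubs -/
  -- identification of paths with the same chart data
  have P_eq_of_chart : ∀ p q : Fin 15, (∀ w : List (Fin 3), w.getLast? ≠ some 0 → (I p w).domain = (I q w).domain) → (∀ w : List (Fin 3), w.getLast? ≠ some 0 → Set.EqOn (I p w).integrand (I q w).integrand (I p w).domain) → P p = P q := by
    intro p q hdom hint
    funext W
    rw [hP, hP]
    split_ifs with hW
    · rfl
    · refine Shuffle.pair_congr fun v hv => ?_
      have hv0 : v.getLast? ≠ some 0 := Shuffle.getLast?_ne_of_mem_support_regEnd 0 W hv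
      have hrel' : KZ.of (I q v) - KZ.of (I p v) ∈ KZ.relations :=
        KZ.of_sub_of_mem_relations_of_eqOn (hdom v hv0)
          (fun t ht => (hint v hv0 (by rw [hdom v hv0]; exact ht)).symm)
      have := hrel _ hrel'
      rw [map_sub, sub_eq_zero] at this
      exact this.symm
  have chartA : ∀ p : Fin 15, p = 6 ∨ p = 7 ∨ p = 8 ∨ p = 9 ∨ p = 12 ∨ p = 13 ∨ p = 14 → P p = P 5 := by
    intro p hp
    refine P_eq_of_chart p 5 (fun w hw => ?_) (fun w hw => ?_)
    · rw [(hI p w hw).1, (hI 5 w hw).1]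
      rcases hp with rfl | rfl | rfl | rfl | rfl | rfl | rfl <;> rfl
    · intro t ht
      have ht5 : t ∈ (I 5 w).domain := by
        rw [(hI 5 w hw).1]; rw [(hI p w hw).1] at ht
        rcases hp with rfl | rfl | rfl | rfl | rfl | rfl | rfl <;> exact ht
      rw [(hI p w hw).2 ht, (hI 5 w hw).2 ht5]
      rcases hp with rfl | rfl | rfl | rfl | rfl | rfl | rfl <;> rfl
  have chartB11 : P 11 = P 10 := by
    refine P_eq_of_chart 11 10 (fun w hw => ?_) (fun w hw => ?_)
    · rw [(hI 11 w hw).1, (hI 10 w hw).1]; rfl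
    · intro t ht
      have ht10 : t ∈ (I 10 w).domain := by
        rw [(hI 10 w hw).1]; rw [(hI 11 w hw).1] at ht; exact ht
      rw [(hI 11 w hw).2 ht, (hI 10 w hw).2 ht10]
      rfl
  -- the two-letter evaluations
  set A : DrinfeldKohnoTrunc R (Fin 4) N → DrinfeldKohnoTrunc R (Fin 4) N → DrinfeldKohnoTrunc R (Fin 4) N :=
    fun x y => NCSeries.evalTrunc N (![x, y, 0] : Fin 3 → DrinfeldKohnoTrunc R (Fin 4) N) (P 5) with hAdef
  set Bf : DrinfeldKohnoTrunc R (Fin 4) N → DrinfeldKohnoTrunc R (Fin 4) N → DrinfeldKohnoTrunc R (Fin 4) N :=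
    fun x w => NCSeries.evalTrunc N (![x, w, 0] : Fin 3 → DrinfeldKohnoTrunc R (Fin 4) N) (P 10) with hBdef
  have m5 : M 5 = A a c := rfl
  have m7 : M 7 = A c a := by rw [hM, chartA 7 (by decide)]; rfl
  have m8 : M 8 = A (a + b + c) (d + e) := by rw [hM, chartA 8 (by decide)]; rfl
  have m9 : M 9 = A (c + d + e) (a + b + c) := by rw [hM, chartA 9 (by decide)]; rfl
  have m6 : M 6 = A (a + b + c) e := by rw [hM, chartA 6 (by decide)]; rfl
  have m14 : M 14 = A e (a + b + c) := by rw [hM, chartA 14 (by decide)]; rfl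
  have m12 : M 12 = A (c + d + e) a := by rw [hM, chartA 12 (by decide)]; rfl
  have m13 : M 13 = A a (c + d) := by rw [hM, chartA 13 (by decide)]; rfl
  have m10 : M 10 = Bf c d := rfl
  have m11 : M 11 = Bf e d := by rw [hM, chartB11]; rfl
  -- coefficients of `P 5` on the letters
  have hP5_0 : P 5 [0] = 0 := by
    rw [hP, if_neg (List.cons_ne_nil _ _), regEnd_zero_singleton, Shuffle.pair_zero]
  have hP5_1 : P 5 [1] = L := by
    rw [hP, if_neg (List.cons_ne_nil _ _), regEnd_zero_singleton_one, Shuffle.pair_single, one_smul]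
  -- central shifts for `A`
  have SL : ∀ {x y z : DrinfeldKohnoTrunc R (Fin 4) N}, x ∈ (DrinfeldKohnoTrunc.genSpan : Submodule R (DrinfeldKohnoTrunc R (Fin 4) N)) → y ∈ (DrinfeldKohnoTrunc.genSpan : Submodule R (DrinfeldKohnoTrunc R (Fin 4) N)) → z ∈ (DrinfeldKohnoTrunc.genSpan : Submodule R (DrinfeldKohnoTrunc R (Fin 4) N)) → Commute z x → Commute z y → A (x + z) y = A x y :=
    fun hx hy hz hzx hzy => evalTrunc_vec3_add_left (hG 5) hP5_0 hx hy hz hzx hzy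
  have SR : ∀ {x y z : DrinfeldKohnoTrunc R (Fin 4) N}, x ∈ (DrinfeldKohnoTrunc.genSpan : Submodule R (DrinfeldKohnoTrunc R (Fin 4) N)) → y ∈ (DrinfeldKohnoTrunc.genSpan : Submodule R (DrinfeldKohnoTrunc R (Fin 4) N)) → z ∈ (DrinfeldKohnoTrunc.genSpan : Submodule R (DrinfeldKohnoTrunc R (Fin 4) N)) → Commute z x → Commute z y → A x (y + z) = A x y * E z := by
    intro x y z hx hy hz hzx hzy
    rw [hE, ← hP5_1]
    exact evalTrunc_vec3_add_right (hG 5) hx hy hz hzx hzy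
  -- the universal identity, instantiated
  have U : ∀ x y : DrinfeldKohnoTrunc R (Fin 4) N, x ∈ (DrinfeldKohnoTrunc.genSpan : Submodule R (DrinfeldKohnoTrunc R (Fin 4) N)) → y ∈ (DrinfeldKohnoTrunc.genSpan : Submodule R (DrinfeldKohnoTrunc R (Fin 4) N)) → A y x * E y * NCSeries.subst₂ N φ x y = A x y * E x := fun x y hx hy => hU x y hx hy
  -- commutation of `E z` with `Φ(x,y)` and with `A`-values is only needed through `z` central:
  have KΦ : ∀ {z x y : DrinfeldKohnoTrunc R (Fin 4) N}, Commute z x → Commute z y → E z * NCSeries.subst₂ N φ x y = NCSeries.subst₂ N φ x y * E z := fun hzx hzy => by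
    rw [hE]
    exact (commute_truncExp_smul (NCSeries.commute_evalTrunc_bsub hzx hzy N φ) L).eq
  have KA : ∀ {z x y : DrinfeldKohnoTrunc R (Fin 4) N}, Commute z x → Commute z y → E z * A x y = A x y * E z := fun {z x y} hzx hzy => by
    rw [hE]
    refine (commute_truncExp_smul (commute_evalTrunc (fun i => ?_) N (P 5)) L).eq
    fin_cases i
    · exact hzx
    · exact hzy
    · exact Commute.zero_right _
  -- H1 (edge 1): directly the universal identity at (a, c)
  have H1 : M 7 * E c * NCSeries.subst₂ N φ a c = M 5 * E a := by
    rw [m7, m5]; exact U a c ga gc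
  -- H2 (edge 2): universal identity at (a+b, d+e), shifts by z₂ = c
  have H2 : M 9 * E (d + e) * NCSeries.subst₂ N φ (a + b) (d + e) = M 8 * E (a + b + c) := by
    have h9 : M 9 = A (d + e) (a + b) * E c := by
      rw [m9, show c + d + e = (d + e) + c by abel, SL gde gabc gc Fc_de Zc_abc, SR gde gab gc Fc_de Fc_ab]
    have h8 : M 8 = A (a + b) (d + e) := by rw [m8, SL gab gde gc Fc_ab Fc_de]
    rw [h9, h8, ← EE (a + b) c Fc_ab.symm gab gc]
    have k1 : E c * E (d + e) = E (d + e) * E c := KE _ _ Fc_de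
    have k2 : E c * NCSeries.subst₂ N φ (a + b) (d + e) = NCSeries.subst₂ N φ (a + b) (d + e) * E c :=
      KΦ Fc_ab Fc_de
    calc A (d + e) (a + b) * E c * E (d + e) * NCSeries.subst₂ N φ (a + b) (d + e)
        = A (d + e) (a + b) * E (d + e) * NCSeries.subst₂ N φ (a + b) (d + e) * E c := by
          rw [mul_assoc (A _ _), k1, ← mul_assoc, mul_assoc _ (E c), k2, ← mul_assoc]
      _ = A (a + b) (d + e) * (E (a + b) * E c) := by rw [U (a + b) (d + e) gab gde, mul_assoc]
  -- H3 (edge 3): chart identity, shifts by -z₃, universal identity at (c, e)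
  have H3 : M 11 * NCSeries.subst₂ N φ c e = M 10 := by
    have gz : -(c + d + e) ∈ (DrinfeldKohnoTrunc.genSpan : Submodule R (DrinfeldKohnoTrunc R (Fin 4) N)) :=
      Submodule.neg_mem _ gcde
    have h10 : M 10 = A c e * E (-(c + d + e)) * E c := by
      rw [m10, hBdef]
      show NCSeries.evalTrunc N ![c, d, 0] (P 10) = _
      rw [hB c d gc gd, show -c - d = e + -(c + d + e) by abel]
      show A c (e + -(c + d + e)) * E c = _
      rw [SR gc ge gz Zcde_c.neg_left Zcde_e.neg_left]
    have h11 : M 11 = A e c * E (-(c + d + e)) * E e := by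
      rw [m11, hBdef]
      show NCSeries.evalTrunc N ![e, d, 0] (P 10) = _
      rw [hB e d ge gd, show -e - d = c + -(c + d + e) by abel]
      show A e (c + -(c + d + e)) * E e = _
      rw [SR ge gc gz Zcde_e.neg_left Zcde_c.neg_left]
    rw [h10, h11]
    have k1 : E (-(c + d + e)) * E e = E e * E (-(c + d + e)) := KE _ _ Zcde_e.neg_left
    have k2 : E (-(c + d + e)) * NCSeries.subst₂ N φ c e = NCSeries.subst₂ N φ c e * E (-(c + d + e)) :=
      KΦ Zcde_c.neg_left Zcde_e.neg_left
    have k3 : E (-(c + d + e)) * E c = E c * E (-(c + d + e)) := KE _ _ Zcde_c.neg_left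
    calc A e c * E (-(c + d + e)) * E e * NCSeries.subst₂ N φ c e
        = A e c * E e * NCSeries.subst₂ N φ c e * E (-(c + d + e)) := by
          rw [mul_assoc (A _ _), k1, ← mul_assoc, mul_assoc _ (E (-(c + d + e))), k2, ← mul_assoc]
      _ = A c e * E c * E (-(c + d + e)) := by rw [U c e gc ge]
      _ = A c e * E (-(c + d + e)) * E c := by rw [mul_assoc, ← k3, ← mul_assoc]
  -- H4 (edge 4): universal identity at (b+c, e), shifts by z₄ = a
  have H4 : M 14 * E e * NCSeries.subst₂ N φ (b + c) e = M 6 * E (a + b + c) := by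
    have h14 : M 14 = A e (b + c) * E a := by
      rw [m14, show a + b + c = (b + c) + a by abel, SR ge gbc ga Fa_e Fa_bc]
    have h6 : M 6 = A (b + c) e := by
      rw [m6, show a + b + c = (b + c) + a by abel, SL gbc ge ga Fa_bc Fa_e]
    rw [h14, h6, show a + b + c = (b + c) + a by abel, ← EE (b + c) a Fa_bc.symm gbc ga]
    have k1 : E a * E e = E e * E a := KE _ _ Fa_e
    have k2 : E a * NCSeries.subst₂ N φ (b + c) e = NCSeries.subst₂ N φ (b + c) e * E a := KΦ Fa_bc Fa_e
    calc A e (b + c) * E a * E e * NCSeries.subst₂ N φ (b + c) e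
        = A e (b + c) * E e * NCSeries.subst₂ N φ (b + c) e * E a := by
          rw [mul_assoc (A _ _), k1, ← mul_assoc, mul_assoc _ (E a), k2, ← mul_assoc]
      _ = A (b + c) e * (E (b + c) * E a) := by rw [U (b + c) e gbc ge, mul_assoc]
  -- H5 (edge 5): universal identity at (a, c+d), left shift by z₅ = e
  have H5 : M 12 * E (c + d) * NCSeries.subst₂ N φ a (c + d) = M 13 * E a := by
    have h12 : M 12 = A (c + d) a := by
      rw [m12, SL gcd ga ge Fe_cd Ze_a]
    rw [h12, m13]; exact U a (c + d) ga gcd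
  /- ### Part (ii): Drinfeld's telescoping -/
  -- commutations of exponentials with transports
  have KM : ∀ (x : DrinfeldKohnoTrunc R (Fin 4) N) (p : Fin 15), (∀ i, Commute x (args p i)) → E x * M p = M p * E x := fun x p hx => by
    rw [hE, hM]; exact (commute_truncExp_smul (commute_evalTrunc hx N (P p)) L).eq
  have k1 : E (a + b + c) * E c = E c * E (a + b + c) := KE _ _ Zabc_c
  have k2 : E (a + b + c) * M 7 = M 7 * E (a + b + c) := KM _ 7 (by
    intro i; fin_cases i
    · exact Zabc_c
    · exact Zabc_a
    · exact Zany_0 _)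
  have k3 : E (a + b + c) * M 5 = M 5 * E (a + b + c) := KM _ 5 (by
    intro i; fin_cases i
    · exact Zabc_a
    · exact Zabc_c
    · exact Zany_0 _)
  have k4 : E c * M 8 = M 8 * E c := KM _ 8 (by
    intro i; fin_cases i
    · exact Zc_abc
    · exact Zc_de
    · exact Zany_0 _)
  have k5 : E c * M 9 = M 9 * E c := KM _ 9 (by
    intro i; fin_cases i
    · exact Zc_cde
    · exact Zc_abc
    · exact Zany_0 _)
  have k6 : E c * E (d + e) = E (d + e) * E c := KE _ _ Zc_de
  have k7 : E (c + d + e) * M 10 = M 10 * E (c + d + e) := KM _ 10 (by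
    intro i; fin_cases i
    · exact Zcde_c
    · exact Zcde_d
    · exact Zany_0 _)
  have k8 : E (c + d + e) * M 11 = M 11 * E (c + d + e) := KM _ 11 (by
    intro i; fin_cases i
    · exact Zcde_e
    · exact Zcde_d
    · exact Zany_0 _)
  have k9 : E a * E e = E e * E a := KE _ _ Za_e
  have k10 : E a * M 14 = M 14 * E a := KM _ 14 (by
    intro i; fin_cases i
    · exact Za_e
    · exact Za_abc
    · exact Zany_0 _)
  have k11 : E a * M 6 = M 6 * E a := KM _ 6 (by
    intro i; fin_cases i
    · exact Za_abc
    · exact Za_e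
    · exact Zany_0 _)
  have k12 : E a * E (a + b + c) = E (a + b + c) * E a := KE _ _ Za_abc
  have k13 : E e * M 13 = M 13 * E e := KM _ 13 (by
    intro i; fin_cases i
    · exact Ze_a
    · exact Ze_cd
    · exact Zany_0 _)
  have k14 : E e * M 12 = M 12 * E e := KM _ 12 (by
    intro i; fin_cases i
    · exact Ze_cde
    · exact Ze_a
    · exact Zany_0 _)
  have k15 : E e * E (c + d) = E (c + d) * E e := KE _ _ Ze_cd
  have X1 : E (d + e) * E c = E (c + d + e) := by
    rw [EE _ _ Fc_de.symm gde gc]; congr 1; abel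
  have X2 : E e * E (c + d) = E (c + d + e) := by
    rw [EE _ _ Fe_cd ge gcd]; congr 1; abel
  -- units
  have hPnil : ∀ p, P p [] = 1 := fun p => by rw [hP]; simp
  have uM : ∀ p, IsUnit (M p) := fun p => isUnit_evalTrunc_of_mem (gargs p) (hPnil p)
  have uE : ∀ {x : DrinfeldKohnoTrunc R (Fin 4) N}, x ∈ (DrinfeldKohnoTrunc.genSpan : Submodule R (DrinfeldKohnoTrunc R (Fin 4) N)) → IsUnit (E x) :=
    fun hx => by rw [hE]; exact isUnit_truncExp_smul hx L
  obtain ⟨m0, hm0⟩ := uM 0; obtain ⟨m1, hm1⟩ := uM 1; obtain ⟨m2, hm2⟩ := uM 2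
  obtain ⟨m3, hm3⟩ := uM 3; obtain ⟨m4, hm4⟩ := uM 4; obtain ⟨m5, hm5⟩ := uM 5
  obtain ⟨m6, hm6⟩ := uM 6; obtain ⟨m7, hm7⟩ := uM 7; obtain ⟨m8, hm8⟩ := uM 8
  obtain ⟨m9, hm9⟩ := uM 9; obtain ⟨m10, hm10⟩ := uM 10; obtain ⟨m11, hm11⟩ := uM 11
  obtain ⟨m12, hm12⟩ := uM 12; obtain ⟨m13, hm13⟩ := uM 13; obtain ⟨m14, hm14⟩ := uM 14
  obtain ⟨ea, hea⟩ := uE ga; obtain ⟨ec, hec⟩ := uE gc; obtain ⟨ee, hee⟩ := uE ge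
  obtain ⟨eabc, heabc⟩ := uE gabc; obtain ⟨ede, hede⟩ := uE gde; obtain ⟨ecd, hecd⟩ := uE gcd
  obtain ⟨ecde, hecde⟩ := uE gcde
  have T : ∀ {u v : (DrinfeldKohnoTrunc R (Fin 4) N)ˣ}, (u : DrinfeldKohnoTrunc R (Fin 4) N) = v → u = v :=
    fun h => Units.ext h
  have key := pentagon_of_corners_group m0 m1 m2 m3 m4 m5 m6 m7 m8 m9 m10 m11 m12 m13 m14
    ea ec ee eabc ede ecd ecde
    (T (by push_cast; rw [hm0, hm5, hm4, hm6]; exact C1))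
    (T (by push_cast; rw [hm0, hm7, hm1, hm8]; exact C2))
    (T (by push_cast; rw [hm2, hm10, hm1, hm9]; exact C3))
    (T (by push_cast; rw [hm2, hm11, hm3, hm12]; exact C4))
    (T (by push_cast; rw [hm4, hm14, hm3, hm13]; exact C5))
    (T (by push_cast; rw [hede, hec, hecde]; exact X1))
    (T (by push_cast; rw [hee, hecd, hecde]; exact X2))
    (T (by push_cast; rw [heabc, hec]; exact k1)) (T (by push_cast; rw [heabc, hm7]; exact k2))
    (T (by push_cast; rw [heabc, hm5]; exact k3)) (T (by push_cast; rw [hec, hm8]; exact k4))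
    (T (by push_cast; rw [hec, hm9]; exact k5)) (T (by push_cast; rw [hec, hede]; exact k6))
    (T (by push_cast; rw [hecde, hm10]; exact k7)) (T (by push_cast; rw [hecde, hm11]; exact k8))
    (T (by push_cast; rw [hea, hee]; exact k9)) (T (by push_cast; rw [hea, hm14]; exact k10))
    (T (by push_cast; rw [hea, hm6]; exact k11)) (T (by push_cast; rw [hea, heabc]; exact k12))
    (T (by push_cast; rw [hee, hm13]; exact k13)) (T (by push_cast; rw [hee, hm12]; exact k14))
    (T (by push_cast; rw [hee, hecd]; exact k15))
  have solve : ∀ {u : (DrinfeldKohnoTrunc R (Fin 4) N)ˣ} {X Y : DrinfeldKohnoTrunc R (Fin 4) N}, (u : DrinfeldKohnoTrunc R (Fin 4) N) * X = Y → X = (↑u⁻¹ : DrinfeldKohnoTrunc R (Fin 4) N) * Y :=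
    fun {u X Y} h => by rw [← h, Units.inv_mul_cancel_left]
  have e1 : NCSeries.subst₂ N φ a c = ↑((m7 * ec)⁻¹ * (m5 * ea)) := by
    rw [Units.val_mul, Units.val_mul, hm5, hea]
    exact solve (by push_cast; rw [hm7, hec]; exact H1)
  have e2 : NCSeries.subst₂ N φ (a + b) (d + e) = ↑((m9 * ede)⁻¹ * (m8 * eabc)) := by
    rw [Units.val_mul, Units.val_mul, hm8, heabc]
    exact solve (by push_cast; rw [hm9, hede]; exact H2)
  have e3 : NCSeries.subst₂ N φ c e = ↑(m11⁻¹ * m10) := by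
    rw [Units.val_mul, hm10]
    exact solve (by rw [hm11]; exact H3)
  have e4 : NCSeries.subst₂ N φ (b + c) e = ↑((m14 * ee)⁻¹ * (m6 * eabc)) := by
    rw [Units.val_mul, Units.val_mul, hm6, heabc]
    exact solve (by push_cast; rw [hm14, hee]; exact H4)
  have e5 : NCSeries.subst₂ N φ a (c + d) = ↑((m12 * ecd)⁻¹ * (m13 * ea)) := by
    rw [Units.val_mul, Units.val_mul, hm13, hea]
    exact solve (by push_cast; rw [hm12, hecd]; exact H5)
  show NCSeries.subst₂ N φ a (c + d) * NCSeries.subst₂ N φ (b + c) e = NCSeries.subst₂ N φ c e * NCSeries.subst₂ N φ (a + b) (d + e) * NCSeries.subst₂ N φ a c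
  rw [e1, e2, e3, e4, e5, ← Units.val_mul, ← Units.val_mul, ← Units.val_mul, key]
  congr 1
  simp only [mul_assoc]

end Summit.KontsevichZagierPeriods.FurushoPentagon.PentagonInKZ
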